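import Literature.Analysis.FluidPDE.CriticalSpaces
import Literature.Analysis.FluidPDE.VectorCalculus
import HarnessLib

/-!
# Barrier: sharp non-uniqueness in critical Besov spaces — small SINGULAR unforced steady states
# `U ∈ Ḃ^{n/p-1}_{p,q}(ℝⁿ)`, `p > n` or `p = n, q > 2` (Fujii 2026)

Barrier catalogue entry for `NavierStokesRegularity` (D-0021). Vendors, as a named fact in a
deliberately weakened but faithful form (see *Rendering*), the steady-state half of Theorem 1.2 of
M. Fujii, *Sharp non-uniqueness for the Navier–Stokes equations in scaling critical spaces*,
arXiv:2602.19846 (2026), with Prop. 1.1 and Rmk. 1.3 as printed context, over the accepted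
vocabulary: tempered distributions `𝓢'(ℝⁿ, ℂⁿ)` and the Littlewood–Paley homogeneous Besov norm
`Literature.Analysis.FunctionSpaces.eHomBesovNorm s p q` / class `MemHomBesov`
(`LittlewoodPaley.lean`, BCD Def. 2.15 — the paper's Def. of `Ḃ^s_{p,q}`, §2, up to the choice
of the dyadic cutoff), the passage field ↦ distribution `Literature.Analysis.FluidPDE.IsDistributionOf`
(`CriticalSpaces.lean`), pointwise divergence-freeness `VectorCalculus.IsDivFree`, the convective
derivative `convect`, test fields `FunctionSpaces.IsTestFunctionOn ⊤` and Mathlib's Laplacian `Δ`.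

## What is printed (Fujii 2026)

* (NS) on `ℝⁿ`, `n ≥ 2`, `ν = 1`: `∂ₜu - Δu + ℙ div(u ⊗ u) = 0`, `div u = 0`, `u(0) = u₀`;
  mild solution = solution of the Duhamel equation (1.3); (sNS): `-ΔU + ℙ div(U ⊗ U) = 0`,
  `div U = 0` on `ℝⁿ` (§1, (1.1)–(1.3)).
* Prop. 1.1 (known; Lions–Masmoudi 2001, Furioli–Lemarié-Rieusset–Terraneo 2000, with
  `Ḃ^0_{n,q} ↪ Lⁿ` for `q ≤ 2`): for `n ≥ 3`, mild solutions are unique in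
  `C([0,T); Ḃ^{n/p-1}_{p,q}(ℝⁿ))` if (U1) `1 ≤ p < n`, `1 ≤ q ≤ ∞`, or (U2) `p = n`, `1 ≤ q ≤ 2`
  (smallness of the solutions needed only for `q = ∞`).
* Thm. 1.2: let `n ≥ 3` and (N1) `p = n`, `2 < q ≤ ∞`, or (N2) `n < p ≤ ∞`, `1 ≤ q ≤ ∞`. There
  exist a decreasing sequence `(ε_m) ⊂ (0,1)`, `ε_m → 0`, and `η = η(n,p,q) ≥ 0` such that for
  every `m` and every datum `u₀ ∈ Ḃ^{n/p-1}_{p,q}` with `‖u₀‖ ≤ η`, `div u₀ = 0`, there exist a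
  non-stationary GLOBAL mild solution `u_m ∈ C([0,∞); Ḃ^{n/p-1}_{p,q}(ℝⁿ))` of (NS) and a
  stationary solution `U_m ∈ Ḃ^{n/p-1}_{p,q}(ℝⁿ)` of (sNS) with `‖u_m(t) - U_m‖ → 0` as `t → ∞`
  and `C⁻¹ε_m ≤ ‖U_m‖_{Ḃ^{n/p-1}_{p,q}} ≤ Cε_m`, `C = C(n,p,q)` independent of `u₀` and `m`.
* Rmk. 1.3: no contradiction with Chemin / Planchon (uniqueness holds in
  `C_t Ḃ ∩ L̃¹_t Ḃ^{n/p+1}`; the new solutions are not in the auxiliary dissipative space); first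
  non-dissipative unforced NS flows with critical regularity; via
  `Ḃ^0_{n,2+δ} ↪ Ḟ^0_{n,2+δ} ↪ Ḟ^{n/p-1}_{p,q}` non-uniqueness from `u₀ = 0` persists in
  `C_t Ḟ^0_{n,q}`, `q > 2` (`Lⁿ = Ḟ^0_{n,2}` is sharp) and unconditional uniqueness of small mild
  solutions in `L^∞(0,T; BMO⁻¹(ℝⁿ))` breaks down (`BMO⁻¹ = Ḟ^{-1}_{∞,2}`); small steady solutions
  are unique in `Lⁿ` (Chen 1993) and in `Ḃ^{n/p-1}_{p,q}` under (U1) (Kaneko–Kozono–Shimizu 2019),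
  so Thm. 1.2 is "sharp non-uniqueness of small solutions" of (sNS); first unforced steady
  non-uniqueness in a scaling-critical space and in 3-D (Luo 2019: `L²(𝕋ⁿ)`, `n ≥ 4`,
  supercritical); the method fails for `n = 2`; Nash-lemma structure, no Beltrami/Mikado blocks;
  same proof on `𝕋ⁿ`.
* §§4–5 (the objects): `U = V + W` where `V = Σ_{j≥1} V_j`, `V_j ∈ C_c^∞(ℝⁿ)` solenoidal blocks
  (Def. 4.4/4.7: amplitudes `λ_{j-1}⁴ Γ_{j,k}[V_{j-1}] ψ_j` from Nash's lemma 4.3, plane waves on the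
  tetration-separated shell `Λ_j` with weights `(h_j ℓ)^{-1/2}`, mollified), the series converging
  absolutely in `Ḃ^{n/p-1}_{p,q}` exactly for (N1)/(N2) (Thm. 4.1 (i)); the residual force
  `F := -ΔV + ℙ div(V ⊗ V)` is DEFINED as the `Ḃ^{n/r-3}_{r,1}`-convergent series `F₁ + F₂ + F₃`
  of §4.2 Step 2 (`n/2 < r < n`), in which the resonant low-frequency part of `V_j ⊗ V_j` cancels
  `-ΔV_{j-1}`; `W ∈ Ḃ^{n/r-1}_{r,1}` solves the perturbed steady system by contraction with the
  paraproduct bound Lemma 2.1 (§5 Step 1), and `u = U + w` with `w` by Chemin–Lerner stability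
  (§5 Step 2, Lemma 2.2).

## Rendering (weaker than print, implied by it)

The steady state `U_m` is a genuine singular distribution of negative regularity (for `p > n`;
its blocks have amplitudes `λ_{j-1}⁴ → ∞`, so `U_m ∉ L²_loc` and `U_m ⊗ U_m` has no a-priori
meaning): in print "`U_m` solves (sNS)" is the identity `F + (-ΔW + ℙ div(V⊗W + W⊗V + W⊗W)) = 0`
in `Ḃ^{n/r-3}_{r,1}` with the series `F` and Bony products.  The tree has NO distribution-level
Navier–Stokes notion (all of `IsSteadyNSSolution`, `IsMildNSSolutionOn`, `IsBesovMildSolutionOn`,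
`IsBoundedWeakNSSolutionOn` take vector FIELDS), no paraproduct and no heat flow on `𝓢'`.  The fact
below therefore renders the solution property of `U_m` in the approximation form into which the
printed identity unwinds (partial sums `Σ_{j≤J} V_j ∈ C_c^∞` plus mollified `W`, continuity of
Lemma 2.1, `ΔV_J → 0` in `Ḃ^{n/p-3}_{p,q}`): **`U_m` is the `Ḃ^{n/p-1}_{p,q}`-norm limit of smooth
divergence-free fields `U_J` whose unforced steady Navier–Stokes defect
`∫ ⟪U_J, (U_J·∇)φ⟫ + ⟪U_J, Δφ⟫`, tested against every smooth compactly supported divergence-free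
`φ`, tends to `0`** — together with the printed norm window `C⁻¹ε_m ≤ ‖U_m‖ ≤ Cε_m`, `ε_m ↓ 0`,
and membership `U_m ∈ Ḃ^{n/p-1}_{p,q}` (realised in `𝓢'_h`, BCD Def. 2.15, legitimate since
`n/p - 1 < n/p`).  The regularity index is written `n / p.toReal - 1` (`= -1` for `p = ∞`, as
printed).  NOT rendered (print-only): the time-dependent half of Thm. 1.2 (the global mild
solutions `u_m → U_m` from every small datum, in particular from `u₀ = 0`) and hence the
non-uniqueness statements in `C_t Ḃ^{n/p-1}_{p,q}`, `C_t Ḟ^0_{n,q}`, `L^∞_t BMO⁻¹` of Rmk. 1.3, and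
Prop. 1.1 — all carried by the citation, not by the Lean text.

## References

* M. Fujii, arXiv:2602.19846 (2026): Prop. 1.1, Thm. 1.2, Rmk. 1.3, §1.3, Lemma 2.1–2.2, §4
  (Lemma 4.3, Def. 4.4/4.7, Thm. 4.1, §4.2), §5 (held: `lit read arxiv:2602.19846`). [`Fujii2026`]
* P.-L. Lions, N. Masmoudi, Comm. PDE 26 (2001) [`LionsMasmoudi2001`]; G. Furioli,
  P. G. Lemarié-Rieusset, E. Terraneo, Rev. Mat. Iberoam. 16 (2000)
  [`FurioliLemarieRieussetTerraneo2000`].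
* H. Koch, D. Tataru, Adv. Math. 157 (2001) [`KochTataruAdvMath2001`]; M. P. Coiculescu,
  S. Palasek, Invent. Math. 244 (2025) [`CoiculescuPalasek2025`]; D. Albritton, Anal. PDE 11
  (2018) [`Albritton2018`].
* H. Bahouri, J.-Y. Chemin, R. Danchin, GL 343 (2011), Def. 2.15 [`BahouriCheminDanchinGL343`].
-/

noncomputable section

open MeasureTheory Set Filter Topology TopologicalSpace
open scoped Laplacian InnerProductSpace RealInnerProductSpace ENNReal NNReal SchwartzMap ContDiff

namespace Literature.Barriers.NavierStokesRegularity

/-- **Barrier (Fujii 2026): small singular unforced steady Navier–Stokes states in every critical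
Besov space `Ḃ^{n/p-1}_{p,q}(ℝⁿ)` beyond `Lⁿ` — the steady-state half of the sharp non-uniqueness
theorem.** For every dimension `n ≥ 3` and every pair of exponents with (N1) `p = n`, `2 < q ≤ ∞`
or (N2) `n < p ≤ ∞`, `1 ≤ q ≤ ∞`, there are `C > 0` and a non-increasing sequence
`ε_m ∈ (0,1)`, `ε_m → 0`, such that for every `m` there is a tempered distribution
`U ∈ Ḃ^{n/p-1}_{p,q}(ℝⁿ; ℂⁿ)` (`MemHomBesov`) with `C⁻¹ ε_m ≤ ‖U‖_{Ḃ^{n/p-1}_{p,q}} ≤ C ε_m`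
(in particular `U ≠ 0` and `U` is as small as desired) which is an unforced steady Navier–Stokes
state (`ν = 1`) in the following sense: `U` is the `Ḃ^{n/p-1}_{p,q}`-norm limit of the
distributions of smooth divergence-free vector fields `U_J : ℝⁿ → ℝⁿ` whose steady
Navier–Stokes defect `∫ (⟪U_J, (U_J·∇)φ⟫ + ⟪U_J, Δφ⟫) dx` tends to `0` for every smooth compactly
supported divergence-free test field `φ`.  In print (Thm. 1.2) `U = U_m` "solves
`-ΔU + ℙ div(U ⊗ U) = 0`, `div U = 0`" through the series/paraproduct identity of §§4–5, and is
moreover the large-time limit of global mild solutions `u_m ∈ C([0,∞); Ḃ^{n/p-1}_{p,q})` issuing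
from ANY divergence-free datum of norm `≤ η`, including `u₀ = 0` — see the module docstring for
what is not rendered. [cite: Fujii2026, Thm. 1.2]

BARRIER (structured block, D-0021):
technique_class: liouville-rigidity-in-critical-besov-norm small-critical-norm-triviality steady-state-uniqueness unconditional-mild-solution-uniqueness mild-solution-uniqueness critical-spaces mild-solutions
blocks: (a) any Liouville / rigidity / small-solution-uniqueness step for STEADY (hence for ancient, time-periodic or globally bounded mild) Navier–Stokes solutions on `ℝⁿ`, `n ≥ 3`, whose only size hypothesis is a critical Besov norm `‖U‖_{Ḃ^{n/p-1}_{p,q}}` with `p > n`, or `p = n` and `q > 2` — even "small norm ⇒ `U = 0`" is false there: "Theorem 1.2 asserts sharp non-uniqueness of small solutions in `Ḃ^{n/p-1}_{p,q}(ℝⁿ)`" for (sNS) [cite: Fujii2026, Rmk. 1.3 (4th item) with Thm. 1.2]; (b) any step treating "the mild solution in `C([0,T); X)`" as a well-defined (unique) object for `X = Ḃ^{n/p-1}_{p,q}` in the ranges (N1)/(N2), for `X = Ḟ^0_{n,q}`, `q > 2`, or for small solutions in `L^∞(0,T; BMO⁻¹(ℝⁿ))`, without an auxiliary (Kato / Chemin–Lerner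 / Koch–Tataru path-space) class — uniqueness of mild solutions holds in `C([0,T); Ḃ^{n/p-1}_{p,q})` iff (U1) `1 ≤ p < n` or (U2) `p = n, q ≤ 2` [cite: Fujii2026, Prop. 1.1, Thm. 1.2 and Rmk. 1.3 (3rd item)]; in the tree this is the caution already recorded against `Literature.Analysis.FluidPDE.gkp_regularity_persistence` (module docstring of `GKPRegularityPersistence.lean`, declared in `GKPCriticalElements.lean`) and it bears on every use of `Literature.Analysis.FluidPDE.IsBesovMildSolutionOn` / `ContinuousInHomBesovOn` as a uniqueness class [cite: Fujii2026, Thm. 1.2].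
because: a Nash-lemma cascade at critical regularity: the principal profile `V = Σ_j V_j` is a sum of compactly supported smooth solenoidal blocks, block `j` being plane waves `cos(λ^ℓ a_k·x) k` spread over a tetration-separated frequency shell `ℓ ∈ Λ_j` with weights `(h_j ℓ)^{-1/2}` and amplitudes `λ_{j-1}⁴ Γ_{j,k}[V_{j-1}] ψ_j` chosen by Nash's decomposition `M = Σ_k Γ_k(M)² k ⊗ k` of `Id - λ_{j-1}^{-8} 𝒟V_{j-1}`, so that the resonant low-frequency part of `V_j ⊗ V_j` cancels `-ΔV_{j-1}` exactly while `‖V_j‖_{Ḃ^{n/p-1}_{p,q}}` shrinks iff (N1)/(N2); the residual force `F = -ΔV + ℙ div(V ⊗ V)` then lies in the well-posedness class `Ḃ^{n/r-3}_{r,1}`, `r < n`, with `‖F‖ ≪ ‖V‖ ≪ 1`, and the correction `W` (steady contraction, Lemma 2.1) and the non-stationary perturbation `w` (Chemin–Lerner stability, Lemma 2.2) are perturbative [cite: Fujii2026, §1.3, Lemma 4.3, Def. 4.4/4.7, Thm. 4.1 and §5].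
evasions_known: measure size in `Lⁿ`, in `Ḃ^{n/p-1}_{p,q}` with (U1) `p < n` or (U2) `p = n, q ≤ 2`, or in the corresponding Triebel–Lizorkin spaces, where mild solutions ARE unique (Lions–Masmoudi 2001 and Furioli–Lemarié-Rieusset–Terraneo 2000 for `C_t Lⁿ`, as reported) [cite: Fujii2026, Prop. 1.1 and §1.1] and small steady solutions are unique (Chen 1993 in `Lⁿ`; Kaneko–Kozono–Shimizu 2019 under (U1)) [cite: Fujii2026, Rmk. 1.3 (4th item)]; keep an auxiliary class — uniqueness in `C_t Ḃ^{n/p-1}_{p,q} ∩ L̃¹_t Ḃ^{n/p+1}_{p,q}` (Chemin 1992, Planchon 1998) is untouched, the new solutions lying outside the dissipative space [cite: Fujii2026, Rmk. 1.3 (1st item)], as is small-data well-posedness in Koch–Tataru's path space [cite: KochTataruAdvMath2001, Thm. 2]; Liouville theorems with POINTWISE or Lebesgue/Lorentz-type hypotheses (boundedness, `|u| ≤ C/|x|`, finite LPS quantity — in-tree `Literature.Analysis.FluidPDE.Seregin2014_ancient_liouville_LPS`, `Literature.Analysis.FluidPDE.knss_bound_C_over_r`) are not affected, the singular states here being unbounded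 distributions outside `L²_loc` [cite: Fujii2026, §4 Def. 4.4/4.7 (amplitudes λ_{j-1}⁴)]; regularity CRITERIA in critical Besov norms (in-tree `Literature.Analysis.FluidPDE.albritton_besov_blowup`, `3 < p, q < ∞`) concern classical solutions and are not uniqueness statements [cite: Albritton2018, Thm. 1.1]; dimension `n = 2` is excluded by the method [cite: Fujii2026, Rmk. 1.3 (5th item)].
scope_caveats: (i) the Lean text renders ONLY the steady states `U_m` of Thm. 1.2, and their solution property in the APPROXIMATION form "Besov-norm limit of smooth divergence-free fields with vanishing steady Navier–Stokes defect against `C_c^∞` solenoidal test fields" — the form into which the printed identity `F + (-ΔW + ℙ div(V⊗W + W⊗V + W⊗W)) = 0` in `Ḃ^{n/r-3}_{r,1}` unwinds (partial sums of the `C_c^∞` blocks, mollified `W`, continuity of the paraproduct bound Lemma 2.1, `ΔV_J → 0` in `Ḃ^{n/p-3}_{p,q}`); the paper writes "`U_m` solves (sNS)" without isolating a solution concept for the singular `U_m ∉ L²_loc`, so this unwinding is the renderer's, not a printed lemma [cite: Fujii2026, §4.2 Step 2 and §5 Step 1]; (ii) NOT rendered: the global mild solutions `u_m ∈ C([0,∞);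 Ḃ^{n/p-1}_{p,q})`, `u_m(t) → U_m`, from every datum with `‖u₀‖ ≤ η`, `div u₀ = 0` (in particular from `u₀ = 0`: infinitely many global solutions from zero initial state), the non-uniqueness corollaries in `C_t Ḃ^{n/p-1}_{p,q}`, `C_t Ḟ^0_{n,q}` (`q > 2`), `L^∞_t BMO⁻¹`, and the uniqueness Prop. 1.1 — the tree has no distribution-valued mild-solution notion; these are carried by the citation only [cite: Fujii2026, Thm. 1.2 and Rmk. 1.3]; (iii) a NON-UNIQUENESS / existence-of-singular-steady-states statement at small critical norm: it constructs no blow-up, says nothing about Leray–Hopf or finite-energy solutions (the states have infinite energy and are not functions), nothing for `p < n`, and nothing about the Clay statement NavierStokesRegularity itself [cite: Fujii2026, §1.2]; (iv) whole space `ℝⁿ`, `n ≥ 3`, `ν = 1` (other viscosities by the scaling `U ↦ ν U`, which multiplies the norm by `ν`); the torus version is asserted to go through "in essentially the same way" but is not written out [cite: Fujii2026, Rmk. 1.3 (last item) and Rmk. 4.5]; (v) arXiv preprint (February 2026), unrefereed at the time of vendoring; no published dissent; Hou–Wang–Yang's computer-assisted unforced 3-D Leray–Hopf non-uniqueness (arXiv:2509.25116)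 is a different, announced result [cite: Fujii2026, §1.1].
status: established -/
def CriticalBesovSteadyNonuniqueness : Prop :=
  ∀ n : ℕ, 3 ≤ n →
    ∀ (p q : ℝ≥0∞) [Fact (1 ≤ p)], 1 ≤ q →
      ((p = n ∧ 2 < q) ∨ (n : ℝ≥0∞) < p) →
        ∃ C : ℝ, 0 < C ∧
          ∃ ε : ℕ → ℝ, Antitone ε ∧ (∀ m, 0 < ε m ∧ ε m < 1) ∧ Tendsto ε atTop (𝓝 0) ∧
            ∀ m : ℕ,
              ∃ U : 𝓢'(EuclideanSpace ℝ (Fin n), EuclideanSpace ℂ (Fin n)),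
                Literature.Analysis.FunctionSpaces.MemHomBesov ((n : ℝ) / p.toReal - 1) p q U ∧
                ENNReal.ofReal (C⁻¹ * ε m) ≤
                    Literature.Analysis.FunctionSpaces.eHomBesovNorm ((n : ℝ) / p.toReal - 1) p q U ∧
                Literature.Analysis.FunctionSpaces.eHomBesovNorm ((n : ℝ) / p.toReal - 1) p q U ≤
                    ENNReal.ofReal (C * ε m) ∧
                ∃ (V : ℕ → EuclideanSpace ℝ (Fin n) → EuclideanSpace ℝ (Fin n))
                  (𝒱 : ℕ → 𝓢'(EuclideanSpace ℝ (Fin n), EuclideanSpace ℂ (Fin n))),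
                  (∀ J, ContDiff ℝ ∞ (V J) ∧ Literature.Analysis.FluidPDE.VectorCalculus.IsDivFree (V J) ∧
                    Literature.Analysis.FluidPDE.IsDistributionOf (V J) (𝒱 J)) ∧
                  Tendsto (fun J => Literature.Analysis.FunctionSpaces.eHomBesovNorm
                      ((n : ℝ) / p.toReal - 1) p q (𝒱 J - U)) atTop (𝓝 0) ∧
                  ∀ φ : EuclideanSpace ℝ (Fin n) → EuclideanSpace ℝ (Fin n),
                    Literature.Analysis.FunctionSpaces.IsTestFunctionOn ⊤ φ →
                    Literature.Analysis.FluidPDE.VectorCalculus.IsDivFree φ →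
                      Tendsto (fun J => ∫ x, (⟪V J x, Literature.Analysis.FluidPDE.convect (V J) φ x⟫ +
                          ⟪V J x, Δ φ x⟫)) atTop (𝓝 0)

/-- Reformulation as the FAILURE OF A LIOUVILLE / SMALL-SOLUTION-UNIQUENESS PRINCIPLE in the
rendered class (Fujii 2026, Rmk. 1.3: "sharp non-uniqueness of small solutions in
`Ḃ^{n/p-1}_{p,q}(ℝⁿ)`" for the steady problem): for `n ≥ 3` and exponents in (N1)/(N2) there is
NO `δ > 0` such that every `U ∈ Ḃ^{n/p-1}_{p,q}` of norm `< δ` which is a Besov-limit of smooth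
divergence-free fields with vanishing steady Navier–Stokes defect must be `0`. Proved from the
barrier fact (take `m` with `C ε_m < δ`; `U ≠ 0` by the lower norm bound). [cite: Fujii2026, Thm. 1.2 with Rmk. 1.3] -/
theorem CriticalBesovSteadyNonuniqueness.no_small_liouville (h : CriticalBesovSteadyNonuniqueness)
    {n : ℕ} (hn : 3 ≤ n) (p q : ℝ≥0∞) [Fact (1 ≤ p)] (hq : 1 ≤ q)
    (hpq : (p = n ∧ 2 < q) ∨ (n : ℝ≥0∞) < p) :
    ¬ ∃ δ : ℝ, 0 < δ ∧
      ∀ U : 𝓢'(EuclideanSpace ℝ (Fin n), EuclideanSpace ℂ (Fin n)),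
        Literature.Analysis.FunctionSpaces.MemHomBesov ((n : ℝ) / p.toReal - 1) p q U →
        Literature.Analysis.FunctionSpaces.eHomBesovNorm ((n : ℝ) / p.toReal - 1) p q U < ENNReal.ofReal δ →
        (∃ (V : ℕ → EuclideanSpace ℝ (Fin n) → EuclideanSpace ℝ (Fin n))
            (𝒱 : ℕ → 𝓢'(EuclideanSpace ℝ (Fin n), EuclideanSpace ℂ (Fin n))),
            (∀ J, ContDiff ℝ ∞ (V J) ∧ Literature.Analysis.FluidPDE.VectorCalculus.IsDivFree (V J) ∧
              Literature.Analysis.FluidPDE.IsDistributionOf (V J) (𝒱 J)) ∧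
            Tendsto (fun J => Literature.Analysis.FunctionSpaces.eHomBesovNorm
                ((n : ℝ) / p.toReal - 1) p q (𝒱 J - U)) atTop (𝓝 0) ∧
            ∀ φ : EuclideanSpace ℝ (Fin n) → EuclideanSpace ℝ (Fin n),
              Literature.Analysis.FunctionSpaces.IsTestFunctionOn ⊤ φ →
              Literature.Analysis.FluidPDE.VectorCalculus.IsDivFree φ →
                Tendsto (fun J => ∫ x, (⟪V J x, Literature.Analysis.FluidPDE.convect (V J) φ x⟫ +
                    ⟪V J x, Δ φ x⟫)) atTop (𝓝 0)) →
        U = 0 := by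
  rintro ⟨δ, hδ, hall⟩
  obtain ⟨C, hC, ε, -, hε, hε0, hU⟩ := h n hn p q hq hpq
  -- choose `m` with `C * ε m < δ`
  have hev : ∀ᶠ m in atTop, C * ε m < δ := by
    have : Tendsto (fun m => C * ε m) atTop (𝓝 (C * 0)) := hε0.const_mul C
    rw [mul_zero] at this
    exact this.eventually (gt_mem_nhds hδ)
  obtain ⟨m, hm⟩ := hev.exists
  obtain ⟨U, hmem, hlow, hup, happrox⟩ := hU m
  have hzero : U = 0 :=
    hall U hmem (lt_of_le_of_lt hup ((ENNReal.ofReal_lt_ofReal_iff hδ).2 hm)) happrox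
  -- but `U ≠ 0`: its norm is at least `C⁻¹ ε m > 0`
  have hpos : 0 < C⁻¹ * ε m := mul_pos (inv_pos.2 hC) (hε m).1
  have : (0 : ℝ≥0∞) < Literature.Analysis.FunctionSpaces.eHomBesovNorm ((n : ℝ) / p.toReal - 1) p q U :=
    lt_of_lt_of_le (ENNReal.ofReal_pos.2 hpos) hlow
  rw [hzero, Literature.Analysis.FunctionSpaces.eHomBesovNorm_zero] at this
  exact lt_irrefl _ this

end Literature.Barriers.NavierStokesRegularity
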